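/- Copyright: the b2b-balaban cell (near-miss cell 7), T⁴-continuum fan-out, NE7b swarm leaf 07 (gen 5; road W-RP, sub-row
«W3n» (offered), file 2 of 2: the COLUMN σ-ALGEBRA and the `loc`∕`sym` suppliers for column events on the tower carrier).
Released under the licence of the surrounding project. -/
import Summits.QuantumFields.BalabanUV.T4Continuum.Support.HistoryRPTowerColumns

/-!
# History chessboard road: the COLUMN σ-ALGEBRA of the tower — `loc` and `sym` for column events (W3n, file 2)

Summits-side support leaf of the T⁴-continuum cell (rung (B)+1 on a FINITE torus only; NOT infinite volume, NOT the
mass gap, NOT the Clay statement; NOT a proof of the spine estimate NE7b).  Road W-RP (R-OWNER-23-2 ∕ R-OWNER-23-8) of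
the swarm claim table `t4/b2b-balaban-t4-ne7b-p1/LEAVES-NE7b.md`, sub-row «W3n» (leaf-07 g5), file 2 of 2, on top of
file 1 (`HistoryRPTowerColumns`: `links`, `under`, `slab`, `sref`, `cutBond_mem_links`, `under_image_sref`,
`sub_scaleCoord_pos_iff`) and leaf-04 g6's W3m (`cutPos`, `cutRefl`, descents `measurable_fst∕snd_cutPos`,
`measurable_coord_of_translate_mem_posBonds`, `cutRefl_zero_apply`, `cutRefl_succ_fst`, `cutRefl_succ_snd_apply`).
[folklore] σ-algebra bookkeeping (Mathlib: `Filtration.piFinset`, `MeasurableSpace.prod`, `measurable_comap_iff`,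
`measurable_pi_iff`); DATA defs `linkAlg`, `colAlg` (σ-algebras); no `structure`, no `[cite:]` tag, no `Prop`-valued
definition (c1), no constant (c2∕c6), no exit ∕ socket ∕ `HistoryConstants` file (c3); nothing printed asserted.

WHAT.
* §1 **`linkAlg G B`** (events of one level depending only on the bond variables in `B`; `linkAlg G (posBonds P j ρ) =
  mPos G j ρ` by `rfl`) and **`colAlg G K S : MeasurableSpace (Tower P G K)`** = the σ-algebra generated by the variables
  of the links INSIDE the columns under the top sites `S`, at every level — structural recursion on the height: the
  prefix read at `under S`, the top field read at `links S`; criteria `measurable_linkAlg_iff` (coordinatewise),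
  `measurable_colAlg_succ_iff` (prefix + top field), `measurable_eval_linkAlg`, `measurable_fst∕snd∕last_colAlg`;
  `linkAlg_le`, `colAlg_le` (sub-σ-algebras of the carrier's).
* §2 THE `loc` SUPPLIER **`colAlg_le_cutPos`**: for a height `K ≤ m + K_P`, a block hyperplane `(i, k)` of the top
  lattice and top sites `S ⊆ slab K i k`, `colAlg G K S ≤ cutPos G K i k` — induction down the tower: the top links of
  slab sites translate into positive bonds (file 1) so their variables are positive-readable (W3m-2), the sites under slab
  sites lie in the slab of the scaled cut (file 1's `under_subset_slab`), and W3m-2's descents carry the prefix.  In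
  W4b′'s letters **`measurableSet_cutPos_of_colAlg`**: `c ∈ halfPlus (P.sitesPerDir K) i k →
  MeasurableSet[colAlg G K {c}] E → MeasurableSet[cutPos G K i k] E`.
* §3 THE `sym` GEOMETRY **`measurable_cutRefl_colAlg`**: `Measurable[colAlg G K (S.image (sref K i k)), colAlg G K S]
  (cutRefl K i k)` — the cut reflection reads each column variable of `S` as a column variable of the reflected sites
  (inverted on `i`-links: `MeasurableInv G`), by induction down the tower with file 1's `cutBond_mem_links` ∕
  `under_image_sref` and W3m-2's coordinate formulas.  In W4b′'s letters **`measurableSet_preimage_cutRefl_of_colAlg`**: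
  `MeasurableSet[colAlg G K {c}] E → MeasurableSet[colAlg G K {cellReflect i k c}] (cutRefl K i k ⁻¹' E)`.
* §4 sanity (`example`s, USE PATTERN for the instantiating seat): the variable of a level-`K` link under a top site of a
  height-`K+1` tower is a `colAlg`-coordinate; for a positive-half top site every `colAlg`-event is a `cutPos`-event.

HONEST SCOPE.  With these two files, for an event model whose cell events are COLUMN EVENTS (`E l c ∈ colAlg G K {c}`)
W4b′'s `loc` is §2 BY NAME, and `sym` reduces to the (R-sym) sentence «`E l (cellReflect i k c) = cutRefl K i k ⁻¹'
E l c`», whose right member §3 places in the correct column algebra — the sentence itself («the reflected template is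
the template of the reflected cell») is the event model's and stays DISPLAYED, exactly as W3e records for one level.
Displayed on road W besides: WHICH events model Bałaban's terms ((EXT): `repr`∕`ev_cover`∕`bad_disj`∕`bad_sub`),
(U1)∕(G2) (`univ_le`); the typing identification «`blockAvg ℰ` is (0.4)» T-class.  Nothing of H3 ∕ (B) ∕ BetaPertH;
NE7b NOT proved; spine 0∕9.  HONEST DEPENDENCY (cell): continuum YM on T⁴ ⇐ BetaPertH ∧ nine spine estimates (0/9
proved); BetaPertH ⇐ (D1) ∧ (D4) ∧ CAP+tail; G-an2-4 gates asym, D1 and NE2/3/4.  This file changes none of it. -/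

open MeasureTheory
open Literature.Barriers.CriticalPhenomena.NonGibbs
open Literature.MathematicalPhysics.QuantumFieldTheory
open Literature.MathematicalPhysics.QuantumFieldTheory.Balaban1983to89
open Summit.QuantumFields.BalabanUV.T4Continuum.HistoryRPHalfTorus
open Summit.QuantumFields.BalabanUV.T4Continuum.HistoryRPTowerLaw
open Summit.QuantumFields.BalabanUV.T4Continuum.HistoryRPTowerCuts
open Summit.QuantumFields.BalabanUV.T4Continuum.HistoryRPTowerCells
open Summit.QuantumFields.BalabanUV.T4Continuum.HistoryRPTowerColumns

namespace Summit.QuantumFields.BalabanUV.T4Continuum.HistoryRPTowerColumnSigma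

noncomputable section

variable {P : Params} {G : Type*}

/-! ## §1 The σ-algebras: link variables of one level, column variables of the tower -/

section Sigma

/-- **THE σ-ALGEBRA OF THE LINK VARIABLES IN `B`** at one level (Mathlib's `Filtration.piFinset`, as W3f's `mPos`). -/
abbrev linkAlg (G : Type*) [MeasurableSpace G] {j : ℕ} (B : Finset (PBond P j)) : MeasurableSpace (GaugeField P j G) :=
  (Filtration.piFinset (X := fun _ : PBond P j => G) B : MeasurableSpace (PBond P j → G))

/-- **THE COLUMN σ-ALGEBRA OF A SET OF TOP SITES**: generated by the variables of the links INSIDE the columns under `S`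
at every level — by structural recursion on the height: the prefix read at the sites `under S`, the top field read at
the links inside `S`. -/
@[reducible] def colAlg (G : Type*) [MeasurableSpace G] : (K : ℕ) → Finset (Site P K) → MeasurableSpace (Tower P G K)
  | 0, S => linkAlg G (links S)
  | K + 1, S => (colAlg G K (under S)).prod (linkAlg G (links S))

variable (G) [MeasurableSpace G]

/-- `linkAlg` of the positive bonds IS W3f's positive σ-algebra `mPos`. [folklore] -/
theorem linkAlg_posBonds (j : ℕ) (ρ : Fin P.d) : linkAlg G (posBonds P j ρ) = mPos G j ρ := rfl

/-- `linkAlg ≤` the product σ-algebra. [folklore] -/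
theorem linkAlg_le {j : ℕ} (B : Finset (PBond P j)) :
    linkAlg G B ≤ (inferInstance : MeasurableSpace (GaugeField P j G)) :=
  (Filtration.piFinset (X := fun _ : PBond P j => G)).le _

/-- **MEASURABILITY INTO `linkAlg`**: a map is `linkAlg B`-measurable iff each of its `B`-coordinates is measurable.
[folklore] -/
theorem measurable_linkAlg_iff {α : Type*} {m : MeasurableSpace α} {j : ℕ} {B : Finset (PBond P j)}
    {f : α → GaugeField P j G} : Measurable[m, linkAlg G B] f ↔ ∀ b ∈ B, Measurable[m] fun a => f a b := by
  refine (measurable_comap_iff (mγ := MeasurableSpace.pi) (g := (B : Set (PBond P j)).restrict) (f := f)).trans ?_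
  refine measurable_pi_iff.trans ?_
  exact ⟨fun h b hb => h ⟨b, hb⟩, fun h b => h b.1 b.2⟩

/-- a `B`-coordinate is `linkAlg B`-measurable. [folklore] -/
theorem measurable_eval_linkAlg {j : ℕ} {B : Finset (PBond P j)} {b : PBond P j} (hb : b ∈ B) :
    Measurable[linkAlg G B] fun U : GaugeField P j G => U b :=
  (measurable_linkAlg_iff G (m := linkAlg G B) (f := id)).1 measurable_id b hb

/-- the recursion at height `0`. [folklore] -/
theorem colAlg_zero (S : Finset (Site P 0)) : colAlg G 0 S = linkAlg G (links S) := rfl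

/-- the recursion at a successor height. [folklore] -/
theorem colAlg_succ (K : ℕ) (S : Finset (Site P (K + 1))) :
    colAlg G (K + 1) S = (colAlg G K (under S)).prod (linkAlg G (links S)) := rfl

/-- `colAlg ≤` the tower's σ-algebra. [folklore] -/
theorem colAlg_le : ∀ (K : ℕ) (S : Finset (Site P K)),
    colAlg G K S ≤ (instMeasurableSpaceTower P G K : MeasurableSpace (Tower P G K))
  | 0, S => linkAlg_le G (links S)
  | K + 1, S => HistoryRPTwoLevel.prod_le_prod (colAlg_le K (under S)) (linkAlg_le G (links S))

/-- the prefix projection is measurable for the column algebras. [folklore] -/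
theorem measurable_fst_colAlg (K : ℕ) (S : Finset (Site P (K + 1))) :
    Measurable[colAlg G (K + 1) S, colAlg G K (under S)] (Prod.fst : Tower P G (K + 1) → Tower P G K) :=
  @measurable_fst _ _ (colAlg G K (under S)) (linkAlg G (links S))

/-- the top-field projection is measurable for the column ∕ link algebras. [folklore] -/
theorem measurable_snd_colAlg (K : ℕ) (S : Finset (Site P (K + 1))) :
    Measurable[colAlg G (K + 1) S, linkAlg G (links S)] (Prod.snd : Tower P G (K + 1) → GaugeField P (K + 1) G) :=
  @measurable_snd _ _ (colAlg G K (under S)) (linkAlg G (links S))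

/-- **MEASURABILITY INTO `colAlg` AT A SUCCESSOR HEIGHT**: prefix into the column algebra of `under S`, top field into
the link algebra of `links S`. [folklore] -/
theorem measurable_colAlg_succ_iff {α : Type*} {m : MeasurableSpace α} {K : ℕ} {S : Finset (Site P (K + 1))}
    {f : α → Tower P G (K + 1)} :
    Measurable[m, colAlg G (K + 1) S] f ↔
      (Measurable[m, colAlg G K (under S)] fun a => (f a).1) ∧
        Measurable[m, linkAlg G (links S)] fun a => (f a).2 :=
  ⟨fun h => ⟨(measurable_fst_colAlg G K S).comp h, (measurable_snd_colAlg G K S).comp h⟩,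
    fun h => Measurable.prod (mβ := colAlg G K (under S)) (mγ := linkAlg G (links S)) h.1 h.2⟩

/-- the top field `last K` is measurable for the column ∕ link algebras. [folklore] -/
theorem measurable_last_colAlg : ∀ (K : ℕ) (S : Finset (Site P K)),
    Measurable[colAlg G K S, linkAlg G (links S)] (last (P := P) (G := G) K)
  | 0, _ => measurable_id
  | K + 1, S => measurable_snd_colAlg G K S

end Sigma

/-! ## §2 The `loc` supplier: column events of slab sites are positive-half events of the cut -/

section Loc

variable (G) [MeasurableSpace G]

/-- the link variables inside a slab set are readable from the transported positive algebra of the cut. [folklore] -/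
theorem linkAlg_links_le {j : ℕ} (i : Fin P.d) (k : ZMod (P.sitesPerDir j)) {S : Finset (Site P j)}
    (hS : S ⊆ slab j i k) :
    linkAlg G (links S) ≤ (mPos G j i).comap (GaugeField.translate (G := G) (cutVec j i k)) := by
  have h : Measurable[(mPos G j i).comap (GaugeField.translate (G := G) (cutVec j i k)), linkAlg G (links S)] id :=
    (measurable_linkAlg_iff G).2 fun b hb =>
      measurable_coord_of_translate_mem_posBonds i (cutVec j i k) b
        (translate_neg_cutVec_mem_posBonds i k (hS (mem_links.1 hb).1) (hS (mem_links.1 hb).2))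
  intro s hs
  exact h hs

/-- **THE `loc` SUPPLIER: THE COLUMN ALGEBRA OF SLAB SITES IS BELOW THE CUT'S POSITIVE ALGEBRA** — for a tower of height
`K ≤ m + K_P`, every block hyperplane `(i, k)` of the top lattice and every set `S` of top sites in its positive slab.
[folklore] -/
theorem colAlg_le_cutPos : ∀ (K : ℕ), K ≤ P.m + P.K → ∀ (i : Fin P.d) (k : ZMod (P.sitesPerDir K))
    (S : Finset (Site P K)), S ⊆ slab K i k → colAlg G K S ≤ cutPos G K i k
  | 0, _, i, k, S, hS => by
    rw [colAlg_zero, cutPos_zero]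
    exact linkAlg_links_le G i k hS
  | K + 1, hK, i, k, S, hS => by
    have IH := colAlg_le_cutPos K (Nat.le_of_succ_le hK) i (Site.scaleCoord P K k) (under S)
      (under_subset_slab hK i k hS)
    have h1 : (colAlg G K (under S)).comap (Prod.fst : Tower P G (K + 1) → Tower P G K) ≤ cutPos G (K + 1) i k :=
      (MeasurableSpace.comap_mono IH).trans (measurable_fst_cutPos K i k).comap_le
    have h2 : (linkAlg G (links S)).comap (Prod.snd : Tower P G (K + 1) → GaugeField P (K + 1) G) ≤
        cutPos G (K + 1) i k :=
      (MeasurableSpace.comap_mono (linkAlg_links_le G i k hS)).trans (measurable_snd_cutPos K i k).comap_le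
    rw [colAlg_succ]
    exact sup_le h1 h2

/-- **`loc` IN W4b′'s LETTERS**: an event in the column algebra of a positive-half top cell is a positive-half event of
the cut. [folklore] -/
theorem measurableSet_cutPos_of_colAlg {K : ℕ} (hK : K ≤ P.m + P.K) {i : Fin P.d} {k : ZMod (P.sitesPerDir K)}
    {c : Site P K} (hc : (c : BlockIdx P.d (P.sitesPerDir K)) ∈ halfPlus (P.sitesPerDir K) i k)
    {E : Set (Tower P G K)} (hE : MeasurableSet[colAlg G K {c}] E) : MeasurableSet[cutPos G K i k] E :=
  colAlg_le_cutPos G K hK i k {c} (fun y hy => by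
    rw [Finset.mem_singleton] at hy
    subst hy
    exact mem_slab_iff_mem_halfPlus.2 hc) E hE

end Loc

/-! ## §3 The `sym` geometry: the cut reflection reads column variables as column variables of the reflected sites -/

section Sym

variable (G) [GaugeGroup G] [MeasurableSpace G] [MeasurableInv G]

/-- **THE `sym` GEOMETRY: `cutRefl K i k` IS MEASURABLE FROM THE COLUMN ALGEBRA OF THE REFLECTED SITES TO THE COLUMN
ALGEBRA OF `S`** (every height `K ≤ m + K_P`, every block hyperplane `(i, k)` of the top lattice). [folklore] -/
theorem measurable_cutRefl_colAlg : ∀ (K : ℕ), K ≤ P.m + P.K → ∀ (i : Fin P.d) (k : ZMod (P.sitesPerDir K))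
    (S : Finset (Site P K)), Measurable[colAlg G K (S.image (sref K i k)), colAlg G K S] (cutRefl (G := G) K i k)
  | 0, _, i, k, S => by
    rw [colAlg_zero, colAlg_zero]
    refine (measurable_linkAlg_iff G).2 fun b hb => ?_
    have e : (fun U : Tower P G 0 => cutRefl 0 i k U b) = fun U : GaugeField P 0 G =>
        if b.dir = i then (U (cutBond i (cutVec 0 i k) b))⁻¹ else U (cutBond i (cutVec 0 i k) b) :=
      funext fun U => cutRefl_zero_apply i k U b
    rw [e]
    by_cases h : b.dir = i
    · simp only [if_pos h]
      exact (measurable_eval_linkAlg G (cutBond_mem_links i k hb)).inv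
    · simp only [if_neg h]
      exact measurable_eval_linkAlg G (cutBond_mem_links i k hb)
  | K + 1, hK, i, k, S => by
    have IH := measurable_cutRefl_colAlg K (Nat.le_of_succ_le hK) i (Site.scaleCoord P K k) (under S)
    refine (measurable_colAlg_succ_iff G).2 ⟨?_, ?_⟩
    · have e : (fun ω : Tower P G (K + 1) => (cutRefl (K + 1) i k ω).1) =
          cutRefl K i (Site.scaleCoord P K k) ∘ (Prod.fst : Tower P G (K + 1) → Tower P G K) :=
        funext fun ω => cutRefl_succ_fst K i k ω
      rw [e]
      refine IH.comp ?_
      rw [← under_image_sref hK i k S]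
      exact measurable_fst_colAlg G K _
    · refine (measurable_linkAlg_iff G).2 fun b hb => ?_
      have e : (fun ω : Tower P G (K + 1) => (cutRefl (K + 1) i k ω).2 b) = fun ω : Tower P G (K + 1) =>
          if b.dir = i then (ω.2 (cutBond i (cutVec (K + 1) i k) b))⁻¹
          else ω.2 (cutBond i (cutVec (K + 1) i k) b) :=
        funext fun ω => cutRefl_succ_snd_apply K i k ω b
      rw [e]
      have hm : Measurable[colAlg G (K + 1) (S.image (sref (K + 1) i k))]
          fun ω : Tower P G (K + 1) => ω.2 (cutBond i (cutVec (K + 1) i k) b) :=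
        (measurable_eval_linkAlg G (cutBond_mem_links i k hb)).comp (measurable_snd_colAlg G K _)
      by_cases h : b.dir = i
      · simp only [if_pos h]
        exact hm.inv
      · simp only [if_neg h]
        exact hm

/-- **`sym` IN W4b′'s LETTERS**: the preimage under the cut reflection of an event in the column algebra of the top
cell `c` is an event in the column algebra of the reflected cell `cellReflect i k c` (= `sref K i k c`). [folklore] -/
theorem measurableSet_preimage_cutRefl_of_colAlg {K : ℕ} (hK : K ≤ P.m + P.K) (i : Fin P.d)
    (k : ZMod (P.sitesPerDir K)) (c : Site P K) {E : Set (Tower P G K)} (hE : MeasurableSet[colAlg G K {c}] E) :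
    MeasurableSet[colAlg G K {(cellReflect i k (c : BlockIdx P.d (P.sitesPerDir K)) : Site P K)}]
      (cutRefl (G := G) K i k ⁻¹' E) := by
  have h := measurable_cutRefl_colAlg G K hK i k {c} hE
  rw [Finset.image_singleton, sref_eq_cellReflect] at h
  exact h

end Sym

/-! ## §4 Sanity: a column coordinate, and its positive-half measurability -/

section Sanity

variable [MeasurableSpace G]

/-- USE PATTERN (instantiating seat): at height `K + 1`, the variable of a level-`K` link `b` under the top site `c`
(both endpoints in the block of `c`) is a `colAlg G (K + 1) {c}`-measurable coordinate. [folklore] -/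
example (K : ℕ) (c : Site P (K + 1)) (b : PBond P K) (hs : blockOf b.src = c) (ht : blockOf b.tgt = c) :
    Measurable[colAlg G (K + 1) {c}] fun ω : Tower P G (K + 1) => last K ω.1 b := by
  have hb : b ∈ links (under ({c} : Finset (Site P (K + 1)))) := by
    rw [mem_links, mem_under, mem_under, hs, ht]
    exact ⟨Finset.mem_singleton_self c, Finset.mem_singleton_self c⟩
  exact ((measurable_eval_linkAlg G hb).comp (measurable_last_colAlg G K _)).comp (measurable_fst_colAlg G K {c})

/-- … hence, for a positive-half top site `c` and `K + 1 ≤ m + K_P`, every `colAlg`-event is a `cutPos G (K + 1) i k`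
event (§2). [folklore] -/
example (K : ℕ) (hK : K + 1 ≤ P.m + P.K) (i : Fin P.d) (k : ZMod (P.sitesPerDir (K + 1))) (c : Site P (K + 1))
    (hc : (c : BlockIdx P.d (P.sitesPerDir (K + 1))) ∈ halfPlus (P.sitesPerDir (K + 1)) i k)
    (E : Set (Tower P G (K + 1))) (hE : MeasurableSet[colAlg G (K + 1) {c}] E) :
    MeasurableSet[cutPos G (K + 1) i k] E :=
  measurableSet_cutPos_of_colAlg G hK hc hE

end Sanity

/-! ## §5 (v1.1 append) Monotonicity of the column algebra in the set of top sites

Asked for by the outside reader of v1 (leaf-09 g7, XREAD l.17208, INFO-2): consumers whose cell events are supported on a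
SUBSET of a cell's top sites (one column inside a cube of file 3 `HistoryRPTowerColumnCubes`, W3e-type two-block
patterns) read `colAlg G K S ≤ colAlg G K S'` for `S ⊆ S'`.  [folklore] -/

section Mono

variable (G) [MeasurableSpace G]

/-- `links` is monotone in the set of sites. [folklore] -/
theorem links_mono {j : ℕ} {S S' : Finset (Site P j)} (h : S ⊆ S') : links S ⊆ links S' := fun b hb => by
  rw [mem_links] at hb ⊢
  exact ⟨h hb.1, h hb.2⟩

/-- `under` is monotone in the set of sites. [folklore] -/
theorem under_mono {j : ℕ} {S S' : Finset (Site P (j + 1))} (h : S ⊆ S') : under S ⊆ under S' := fun x hx => by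
  rw [mem_under] at hx ⊢
  exact h hx

/-- `linkAlg` is monotone in the set of bonds (`Filtration.mono`). [folklore] -/
theorem linkAlg_mono {j : ℕ} {B B' : Finset (PBond P j)} (h : B ⊆ B') : linkAlg G B ≤ linkAlg G B' :=
  (Filtration.piFinset (X := fun _ : PBond P j => G)).mono h

/-- **THE COLUMN ALGEBRA IS MONOTONE IN THE SET OF TOP SITES**: `S ⊆ S' → colAlg G K S ≤ colAlg G K S'`. [folklore] -/
theorem colAlg_mono : ∀ (K : ℕ) {S S' : Finset (Site P K)}, S ⊆ S' → colAlg G K S ≤ colAlg G K S'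
  | 0, _, _, h => linkAlg_mono G (links_mono h)
  | K + 1, _, _, h => HistoryRPTwoLevel.prod_le_prod (colAlg_mono K (under_mono h)) (linkAlg_mono G (links_mono h))

/-- the column algebra of ONE top site of `S` is below the column algebra of `S` (e.g. one column inside a cube).
[folklore] -/
theorem colAlg_singleton_le {K : ℕ} {S : Finset (Site P K)} {c : Site P K} (hc : c ∈ S) :
    colAlg G K {c} ≤ colAlg G K S :=
  colAlg_mono G K (Finset.singleton_subset_iff.2 hc)

end Mono

end

end Summit.QuantumFields.BalabanUV.T4Continuum.HistoryRPTowerColumnSigma
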